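import Summits.QuantumFields.YangMills.Theorems.ColdStartUniversalityLatticeLangevinLiebRobinsonClustering
import HarnessLib

/-!
# Route `ColdStartUniversality` (fixed-cut-off SZZ dynamics; LIEB–ROBINSON / LOCALITY package, file 18):
# ★★★ DYNAMIC CLUSTERING FROM EVERY DETERMINISTIC START — along the cold-start evolution distant loops are uncorrelated,
# uniformly in the volume (`|β'| < 1/12`)

Helper file (seat `ym-line-csu-p1`, g31; `--supports stmt-QuantumFields-24809`).  The static clustering theorem of file 16
(`wilson_covariance_abs_le_of_separated'`) transported along the every-start, volume-free local mixing theorem of g30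
(`wilson_local_pointwise_mixing_of_linkLipschitz`, applied to `F`, `G` and the product `F·G`, whose profile is `M_F ℓ^G + M_G ℓ^F`):
* `linkLipschitz_mul` — the link-Lipschitz profile of a product of bounded observables;
* ★★★ `transition_covariance_abs_le_of_separated` — for EVERY realising kernel family `κ`, every start `x`, every lattice time `t`, and `C⁵` cylinder
  observables `F, G` (bounds `M_F, M_G`, profiles `ℓ^F, ℓ^G` on link sets `Λ_F, Λ_G` at cyclic sup-distance `≥ R+1`):
  `|κ_t(FG)(x) − κ_tF(x)·κ_tG(x)| ≤ 8 Σℓ^F Σℓ^G (1+T_R) e^(−ρT_R) + 12π((3(λ+ρ)t+1)³+2)e^(−ρt)·(#(Λ_F∪Λ_G)√Σ(M_Fℓ^G+M_Gℓ^F)² + M_G#Λ_F√Σ(ℓ^F)² + M_F#Λ_G√Σ(ℓ^G)²)`,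
  `T_R = (R+1) log 108/(λ+ρ)`, `ρ = 1 − 12|β'|`, `λ = (1300+4√2)|β'|` — NO volume factor anywhere;
* ★★★ `solution_covariance_abs_le_of_separated` — the same along every strong SZZ solution from a deterministic start (any filtered probability
  space, any flat Brownian driver), in particular along the COLD-START evolution `U_0 ≡ 1` of the route.
THEOREMS ONLY, no definition, no sorry; [folklore].  HONEST FRAMING: fixed cut-off, FIXED strong-coupling window `|β'| < 1/12`, lattice time; along
the route's scaling `β'_K = (γε_K)⁻¹/2 → ∞` the window is left, so this is NOT the cut-off-uniform cold-start statement of the crux;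
`UniformColdStartMixing` (24809) is NOT restated; no crux, rung or summit statement is proved; the Yang–Mills mass gap is NOT proved.
-/

set_option autoImplicit false

noncomputable section

namespace Summit.QuantumFields.YangMills.Theorems.ColdStartUniversality.LiebRobinson

open MeasureTheory ProbabilityTheory Matrix Complex Finset Filter Set Metric intervalIntegral
open scoped ComplexConjugate BigOperators Matrix NNReal ENNReal Topology
open Literature.Probability.Process Literature.MathematicalPhysics.QuantumFieldTheory
open Literature.MathematicalPhysics.QuantumFieldTheory.Balaban1983to89
open Literature.MathematicalPhysics.QuantumLattice (fundamentalRep fundamentalLatticeRep continuous_fundamentalRep fundamentalRep_apply)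

variable {L : ℕ} [NeZero L]

/-! ## Dynamic clustering from EVERY deterministic start (e.g. the cold start) -/

omit [NeZero L] in
/-- **Link-Lipschitz profile of a product.**  If `F`, `G` have profiles `ℓ^F`, `ℓ^G` and `|F| ≤ M_F`, `|G| ≤ M_G`, then `F·G` has the
profile `M_F·ℓ^G + M_G·ℓ^F`. [folklore] -/
theorem linkLipschitz_mul {F G : GaugeConfig 3 L (Matrix.specialUnitaryGroup (Fin 2) ℂ) → ℝ} {ℓF ℓG : Edge 3 L → ℝ} {MF MG : ℝ}
    (hMF : ∀ y, |F y| ≤ MF) (hMG : ∀ y, |G y| ≤ MG)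
    (hLF : ∀ (e : Edge 3 L) (y y' : (GaugeConfig 3 L (Matrix.specialUnitaryGroup (Fin 2) ℂ))), (∀ f', f' ≠ e → y f' = y' f') →
      |F y - F y'| ≤ ℓF e * frobNorm ((y e : Matrix (Fin 2) (Fin 2) ℂ) - (y' e : Matrix (Fin 2) (Fin 2) ℂ)))
    (hLG : ∀ (e : Edge 3 L) (y y' : (GaugeConfig 3 L (Matrix.specialUnitaryGroup (Fin 2) ℂ))), (∀ f', f' ≠ e → y f' = y' f') →
      |G y - G y'| ≤ ℓG e * frobNorm ((y e : Matrix (Fin 2) (Fin 2) ℂ) - (y' e : Matrix (Fin 2) (Fin 2) ℂ)))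
    (e : Edge 3 L) (y y' : (GaugeConfig 3 L (Matrix.specialUnitaryGroup (Fin 2) ℂ))) (hyy' : ∀ f', f' ≠ e → y f' = y' f') :
    |F y * G y - F y' * G y'| ≤ (MF * ℓG e + MG * ℓF e) * frobNorm ((y e : Matrix (Fin 2) (Fin 2) ℂ) - (y' e : Matrix (Fin 2) (Fin 2) ℂ)) := by
  have hd : 0 ≤ frobNorm ((y e : Matrix (Fin 2) (Fin 2) ℂ) - (y' e : Matrix (Fin 2) (Fin 2) ℂ)) := frobNorm_nonneg _
  have h1 := hLF e y y' hyy'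
  have h2 := hLG e y y' hyy'
  calc |F y * G y - F y' * G y'| = |F y * (G y - G y') + (F y - F y') * G y'| := by ring_nf
    _ ≤ |F y * (G y - G y')| + |(F y - F y') * G y'| := abs_add_le _ _
    _ = |F y| * |G y - G y'| + |F y - F y'| * |G y'| := by rw [abs_mul, abs_mul]
    _ ≤ MF * (ℓG e * frobNorm ((y e : Matrix (Fin 2) (Fin 2) ℂ) - (y' e : Matrix (Fin 2) (Fin 2) ℂ))) +
        (ℓF e * frobNorm ((y e : Matrix (Fin 2) (Fin 2) ℂ) - (y' e : Matrix (Fin 2) (Fin 2) ℂ))) * MG :=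
        add_le_add (mul_le_mul (hMF y) h2 (abs_nonneg _) ((abs_nonneg _).trans (hMF y)))
          (mul_le_mul h1 (hMG y') (abs_nonneg _) ((abs_nonneg _).trans h1))
    _ = (MF * ℓG e + MG * ℓF e) * frobNorm ((y e : Matrix (Fin 2) (Fin 2) ℂ) - (y' e : Matrix (Fin 2) (Fin 2) ℂ)) := by ring

/-- ★★★ **DYNAMIC CLUSTERING FROM EVERY DETERMINISTIC START** (`|β'| < 1/12`, every volume `L`, every realising kernel family, e.g. along the
COLD-START evolution).  For `C⁵` cylinder observables `F = f∘coords`, `G = g∘coords` bounded by `M_F, M_G`, with link-Lipschitz profiles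
`ℓ^F, ℓ^G` supported on `Λ_F, Λ_G` whose base sites are at cyclic sup-distance `≥ R+1`, every start `x` and every lattice time `t`:
`|κ_t(F·G)(x) − κ_tF(x)·κ_tG(x)| ≤ 8 Σℓ^F Σℓ^G (1 + T_R) e^(−ρT_R)`
`  + 12π·((3(λ+ρ)t+1)³+2)·e^(−ρt)·(#(Λ_F ∪ Λ_G)·√Σ(M_Fℓ^G + M_Gℓ^F)² + M_G·#Λ_F·√Σ(ℓ^F)² + M_F·#Λ_G·√Σ(ℓ^G)²)`:
distant loops are uncorrelated under the time-`t` law from ANY start as soon as `t` exceeds a VOLUME-INDEPENDENT time — static clustering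
(`wilson_covariance_abs_le_of_separated'`) transported along the every-start, volume-free local mixing theorem of g30
(`wilson_local_pointwise_mixing_of_linkLipschitz`, applied to `F`, `G` and `F·G`).  Fixed cut-off; `UniformColdStartMixing` (24809) is NOT restated;
the Yang–Mills mass gap is NOT proved. [folklore] -/
theorem transition_covariance_abs_le_of_separated (L : ℕ) [NeZero L] (β' : ℝ) (hβ : |β'| < 1 / 12)
    (κ : ℝ≥0 → Kernel (GaugeConfig 3 L (Matrix.specialUnitaryGroup (Fin 2) ℂ))
      (GaugeConfig 3 L (Matrix.specialUnitaryGroup (Fin 2) ℂ))) [∀ t, IsMarkovKernel (κ t)]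
    (hreal : ∀ (t : ℝ≥0) (x : GaugeConfig 3 L (Matrix.specialUnitaryGroup (Fin 2) ℂ))
        (Ω : Type) [MeasurableSpace Ω] (P : Measure Ω) [IsProbabilityMeasure P]
        (W : ℝ≥0 → Ω → (Edge 3 L × NoiseIdx 2 → ℝ)) (hW : IsFlatBrownian W P)
        (U : ℝ≥0 → Ω → GaugeConfig 3 L (Matrix.specialUnitaryGroup (Fin 2) ℂ)),
        (∀ ω, U 0 ω = x) →
        (latticeLangevinDynamics (fundamentalLatticeRep 2) β').IsSolution (fundamentalRep (Fin 2))
          hW.natFiltration P W U →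
        κ t x = P.map (U t))
    {f : (Edge 3 L × Fin 2 × Fin 2 × Bool → ℝ) → ℝ} (hf : ContDiff ℝ 5 f) {ℓF : Edge 3 L → ℝ} (hℓF : ∀ e, 0 ≤ ℓF e) {MF : ℝ}
    {g : (Edge 3 L × Fin 2 × Fin 2 × Bool → ℝ) → ℝ} (hg : ContDiff ℝ 5 g) {ℓG : Edge 3 L → ℝ} (hℓG : ∀ e, 0 ≤ ℓG e) {MG : ℝ}
    (Λf Λg : Finset (Edge 3 L)) (hΛf : ∀ e, e ∉ Λf → ℓF e = 0) (hΛg : ∀ e, e ∉ Λg → ℓG e = 0) (R : ℕ)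
    (hsep : ∀ e' ∈ Λf, ∀ e ∈ Λg, R + 1 ≤ (Finset.univ.sup fun i : Fin 3 => ((e'.1 i - e.1 i).valMinAbs).natAbs)) (t : ℝ≥0) (x : GaugeConfig 3 L (Matrix.specialUnitaryGroup (Fin 2) ℂ)) :
    let coords : GaugeConfig 3 L (Matrix.specialUnitaryGroup (Fin 2) ℂ) → (Edge 3 L × Fin 2 × Fin 2 × Bool → ℝ) :=
      fun V q => (fun z : ℂ => if q.2.2.2 then z.im else z.re)
        ((fundamentalRep (Fin 2) (V q.1) : Matrix (Fin 2) (Fin 2) ℂ) q.2.1 q.2.2.1)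
    (∀ y, |f (coords y)| ≤ MF) → (∀ y, |g (coords y)| ≤ MG) →
    (∀ (e : Edge 3 L) (y y' : (GaugeConfig 3 L (Matrix.specialUnitaryGroup (Fin 2) ℂ))), (∀ f', f' ≠ e → y f' = y' f') →
      |f (coords y) - f (coords y')| ≤ ℓF e * frobNorm ((y e : Matrix (Fin 2) (Fin 2) ℂ) - (y' e : Matrix (Fin 2) (Fin 2) ℂ))) →
    (∀ (e : Edge 3 L) (y y' : (GaugeConfig 3 L (Matrix.specialUnitaryGroup (Fin 2) ℂ))), (∀ f', f' ≠ e → y f' = y' f') →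
      |g (coords y) - g (coords y')| ≤ ℓG e * frobNorm ((y e : Matrix (Fin 2) (Fin 2) ℂ) - (y' e : Matrix (Fin 2) (Fin 2) ℂ))) →
    |(∫ y, f (coords y) * g (coords y) ∂(κ t x)) - (∫ y, f (coords y) ∂(κ t x)) * (∫ y, g (coords y) ∂(κ t x))| ≤
      8 * (∑ e : Edge 3 L, ℓF e) * (∑ e : Edge 3 L, ℓG e) * (1 + (((R : ℝ) + 1) * Real.log 108 / ((1300 + 4 * Real.sqrt 2) * |β'| + (1 - 12 * |β'|)))) * Real.exp (-((1 - 12 * |β'|) * (((R : ℝ) + 1) * Real.log 108 / ((1300 + 4 * Real.sqrt 2) * |β'| + (1 - 12 * |β'|))))) +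
      12 * Real.pi * ((3 * (((1300 + 4 * Real.sqrt 2) * |β'| + (1 - 12 * |β'|)) * (t : ℝ)) + 1) ^ 3 + 2) * Real.exp (-((1 - 12 * |β'|) * (t : ℝ))) *
        (((Λf ∪ Λg).card : ℝ) * Real.sqrt (∑ e : Edge 3 L, (MF * ℓG e + MG * ℓF e) ^ 2) +
          MG * (Λf.card : ℝ) * Real.sqrt (∑ e : Edge 3 L, ℓF e ^ 2) + MF * (Λg.card : ℝ) * Real.sqrt (∑ e : Edge 3 L, ℓG e ^ 2)) := by
  intro coords hMF hMG hLf hLg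
  classical
  haveI := secondCountableTopology_su2
  haveI := borelSpace_config L
  set μ : Measure (GaugeConfig 3 L (Matrix.specialUnitaryGroup (Fin 2) ℂ)) := (wilsonMeasure (d := 3) (L := L) (fundamentalRep (Fin 2)) β') with hμ
  haveI : IsProbabilityMeasure μ :=
    isProbabilityMeasure_wilsonMeasure (d := 3) (L := L) (fundamentalRep (Fin 2)) (continuous_fundamentalRep (Fin 2)) β'
  haveI : IsProbabilityMeasure (κ t x) := inferInstance
  have hMF0 : 0 ≤ MF := (abs_nonneg _).trans (hMF x)
  have hMG0 : 0 ≤ MG := (abs_nonneg _).trans (hMG x)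
  -- static clustering
  have hstat : |(∫ y, f (coords y) * g (coords y) ∂μ) - (∫ y, f (coords y) ∂μ) * (∫ y, g (coords y) ∂μ)| ≤
      8 * (∑ e : Edge 3 L, ℓF e) * (∑ e : Edge 3 L, ℓG e) * (1 + (((R : ℝ) + 1) * Real.log 108 / ((1300 + 4 * Real.sqrt 2) * |β'| + (1 - 12 * |β'|)))) * Real.exp (-((1 - 12 * |β'|) * (((R : ℝ) + 1) * Real.log 108 / ((1300 + 4 * Real.sqrt 2) * |β'| + (1 - 12 * |β'|))))) :=
    wilson_covariance_abs_le_of_separated' L β' hβ (hf.of_le (by norm_num)) hℓF (hg.of_le (by norm_num)) hℓG Λf Λg hΛf hΛg R hsep hLf hLg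
  -- every-start mixing of `F`, `G` and `F·G`
  have hmF : |(∫ y, f (coords y) ∂(κ t x)) - ∫ y, f (coords y) ∂μ| ≤
      12 * Real.pi * Λf.card * Real.sqrt (∑ e : Edge 3 L, ℓF e ^ 2) * ((3 * (((1300 + 4 * Real.sqrt 2) * |β'| + (1 - 12 * |β'|)) * (t : ℝ)) + 1) ^ 3 + 2) * Real.exp (-((1 - 12 * |β'|) * (t : ℝ))) :=
    wilson_local_pointwise_mixing_of_linkLipschitz L β' hβ κ hreal hf Λf hℓF hΛf t hLf x
  have hmG : |(∫ y, g (coords y) ∂(κ t x)) - ∫ y, g (coords y) ∂μ| ≤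
      12 * Real.pi * Λg.card * Real.sqrt (∑ e : Edge 3 L, ℓG e ^ 2) * ((3 * (((1300 + 4 * Real.sqrt 2) * |β'| + (1 - 12 * |β'|)) * (t : ℝ)) + 1) ^ 3 + 2) * Real.exp (-((1 - 12 * |β'|) * (t : ℝ))) :=
    wilson_local_pointwise_mixing_of_linkLipschitz L β' hβ κ hreal hg Λg hℓG hΛg t hLg x
  have hfg : ContDiff ℝ 5 (fun z => f z * g z) := hf.mul hg
  have hℓFG0 : ∀ e, 0 ≤ MF * ℓG e + MG * ℓF e := fun e => by
    have := hℓF e; have := hℓG e; positivity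
  have hΛFG : ∀ e, e ∉ Λf ∪ Λg → MF * ℓG e + MG * ℓF e = 0 := by
    intro e he
    rw [Finset.mem_union, not_or] at he
    rw [hΛf e he.1, hΛg e he.2, mul_zero, mul_zero, add_zero]
  have hLfg : (∀ (e : Edge 3 L) (y y' : (GaugeConfig 3 L (Matrix.specialUnitaryGroup (Fin 2) ℂ))), (∀ f', f' ≠ e → y f' = y' f') →
      |(fun z => f z * g z) (coords y) - (fun z => f z * g z) (coords y')| ≤ (fun e => MF * ℓG e + MG * ℓF e) e * frobNorm ((y e : Matrix (Fin 2) (Fin 2) ℂ) - (y' e : Matrix (Fin 2) (Fin 2) ℂ))) :=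
    fun e y y' h => linkLipschitz_mul (F := fun y => f (coords y)) (G := fun y => g (coords y)) hMF hMG hLf hLg e y y' h
  have hmFG : |(∫ y, (fun z => f z * g z) (coords y) ∂(κ t x)) - ∫ y, (fun z => f z * g z) (coords y) ∂μ| ≤
      12 * Real.pi * (Λf ∪ Λg).card * Real.sqrt (∑ e : Edge 3 L, (MF * ℓG e + MG * ℓF e) ^ 2) * ((3 * (((1300 + 4 * Real.sqrt 2) * |β'| + (1 - 12 * |β'|)) * (t : ℝ)) + 1) ^ 3 + 2) * Real.exp (-((1 - 12 * |β'|) * (t : ℝ))) :=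
    wilson_local_pointwise_mixing_of_linkLipschitz L β' hβ κ hreal hfg (Λf ∪ Λg) hℓFG0 hΛFG t hLfg x
  simp only [] at hmFG
  -- the means along the dynamics are bounded
  have hco : Continuous coords := continuous_coords (L := L)
  have hGc : Continuous fun V => g (coords V) := hg.continuous.comp hco
  have hκG : |∫ y, g (coords y) ∂(κ t x)| ≤ MG := abs_integral_le_of_abs_le_of_isProbabilityMeasure hMG
  have hμF : |∫ y, f (coords y) ∂μ| ≤ MF := abs_integral_le_of_abs_le_of_isProbabilityMeasure hMF
  -- algebra
  set A := ∫ y, f (coords y) * g (coords y) ∂(κ t x) with hA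
  set B := ∫ y, f (coords y) ∂(κ t x) with hB
  set C := ∫ y, g (coords y) ∂(κ t x) with hC
  set A₀ := ∫ y, f (coords y) * g (coords y) ∂μ with hA₀
  set B₀ := ∫ y, f (coords y) ∂μ with hB₀
  set C₀ := ∫ y, g (coords y) ∂μ with hC₀
  have hden : 0 < (1300 + 4 * Real.sqrt 2) * |β'| + (1 - 12 * |β'|) := by
    have h0 : 0 ≤ (1300 + 4 * Real.sqrt 2) * |β'| := by positivity
    linarith
  have hb : 0 ≤ 3 * (((1300 + 4 * Real.sqrt 2) * |β'| + (1 - 12 * |β'|)) * (t : ℝ)) + 1 := by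
    have := mul_nonneg hden.le (NNReal.coe_nonneg t); linarith
  have hpoly : 0 ≤ (3 * (((1300 + 4 * Real.sqrt 2) * |β'| + (1 - 12 * |β'|)) * (t : ℝ)) + 1) ^ 3 + 2 := add_nonneg (pow_nonneg hb 3) (by norm_num)
  have hmix0 : 0 ≤ 12 * Real.pi * Λf.card * Real.sqrt (∑ e : Edge 3 L, ℓF e ^ 2) * ((3 * (((1300 + 4 * Real.sqrt 2) * |β'| + (1 - 12 * |β'|)) * (t : ℝ)) + 1) ^ 3 + 2) * Real.exp (-((1 - 12 * |β'|) * (t : ℝ))) :=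
    mul_nonneg (mul_nonneg (by positivity) hpoly) (Real.exp_pos _).le
  have hid : A - B * C = (A - A₀) + (A₀ - B₀ * C₀) + (B₀ * (C₀ - C)) + ((B₀ - B) * C) := by ring
  rw [hid]
  have h3 : |B₀ * (C₀ - C)| ≤ MF * (12 * Real.pi * Λg.card * Real.sqrt (∑ e : Edge 3 L, ℓG e ^ 2) * ((3 * (((1300 + 4 * Real.sqrt 2) * |β'| + (1 - 12 * |β'|)) * (t : ℝ)) + 1) ^ 3 + 2) * Real.exp (-((1 - 12 * |β'|) * (t : ℝ)))) := by
    rw [abs_mul, ← abs_neg (C₀ - C), neg_sub]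
    exact mul_le_mul hμF hmG (abs_nonneg _) hMF0
  have h4 : |(B₀ - B) * C| ≤ (12 * Real.pi * Λf.card * Real.sqrt (∑ e : Edge 3 L, ℓF e ^ 2) * ((3 * (((1300 + 4 * Real.sqrt 2) * |β'| + (1 - 12 * |β'|)) * (t : ℝ)) + 1) ^ 3 + 2) * Real.exp (-((1 - 12 * |β'|) * (t : ℝ)))) * MG := by
    rw [abs_mul, ← abs_neg (B₀ - B), neg_sub]
    exact mul_le_mul hmF hκG (abs_nonneg _) hmix0
  calc |(A - A₀) + (A₀ - B₀ * C₀) + (B₀ * (C₀ - C)) + ((B₀ - B) * C)|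
      ≤ |A - A₀| + |A₀ - B₀ * C₀| + |B₀ * (C₀ - C)| + |(B₀ - B) * C| := by
        refine (abs_add_le _ _).trans (add_le_add ((abs_add_le _ _).trans (add_le_add (abs_add_le _ _) le_rfl)) le_rfl)
    _ ≤ 12 * Real.pi * (Λf ∪ Λg).card * Real.sqrt (∑ e : Edge 3 L, (MF * ℓG e + MG * ℓF e) ^ 2) * ((3 * (((1300 + 4 * Real.sqrt 2) * |β'| + (1 - 12 * |β'|)) * (t : ℝ)) + 1) ^ 3 + 2) * Real.exp (-((1 - 12 * |β'|) * (t : ℝ))) +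
        8 * (∑ e : Edge 3 L, ℓF e) * (∑ e : Edge 3 L, ℓG e) * (1 + (((R : ℝ) + 1) * Real.log 108 / ((1300 + 4 * Real.sqrt 2) * |β'| + (1 - 12 * |β'|)))) * Real.exp (-((1 - 12 * |β'|) * (((R : ℝ) + 1) * Real.log 108 / ((1300 + 4 * Real.sqrt 2) * |β'| + (1 - 12 * |β'|))))) +
        MF * (12 * Real.pi * Λg.card * Real.sqrt (∑ e : Edge 3 L, ℓG e ^ 2) * ((3 * (((1300 + 4 * Real.sqrt 2) * |β'| + (1 - 12 * |β'|)) * (t : ℝ)) + 1) ^ 3 + 2) * Real.exp (-((1 - 12 * |β'|) * (t : ℝ)))) +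
        (12 * Real.pi * Λf.card * Real.sqrt (∑ e : Edge 3 L, ℓF e ^ 2) * ((3 * (((1300 + 4 * Real.sqrt 2) * |β'| + (1 - 12 * |β'|)) * (t : ℝ)) + 1) ^ 3 + 2) * Real.exp (-((1 - 12 * |β'|) * (t : ℝ)))) * MG :=
        add_le_add (add_le_add (add_le_add hmFG hstat) h3) h4
    _ = _ := by ring


/-- ★★★ **Dynamic clustering ALONG EVERY SZZ SOLUTION from a deterministic start** (e.g. the COLD start `U_0 ≡ 1`; any filtered probability
space, any flat Brownian driver; `|β'| < 1/12`, every volume): with the notation of `transition_covariance_abs_le_of_separated`,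
`|E[F(U_t)G(U_t)] − E[F(U_t)]·E[G(U_t)]|` obeys the same bound — separated loops are uncorrelated at all times beyond a volume-independent
transient.  Fixed cut-off; `UniformColdStartMixing` (24809) is NOT restated; the Yang–Mills mass gap is NOT proved. [folklore] -/
theorem solution_covariance_abs_le_of_separated (L : ℕ) [NeZero L] (β' : ℝ) (hβ : |β'| < 1 / 12) (t : ℝ≥0)
    (x₀ : (GaugeConfig 3 L (Matrix.specialUnitaryGroup (Fin 2) ℂ)))
    (Ω : Type) [MeasurableSpace Ω] (P : Measure Ω) [IsProbabilityMeasure P]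
    (W : ℝ≥0 → Ω → (Edge 3 L × NoiseIdx 2 → ℝ)) (hW : IsFlatBrownian W P)
    (U : ℝ≥0 → Ω → (GaugeConfig 3 L (Matrix.specialUnitaryGroup (Fin 2) ℂ))) (hU0 : ∀ ω, U 0 ω = x₀)
    (hU : (latticeLangevinDynamics (fundamentalLatticeRep 2) β').IsSolution (fundamentalRep (Fin 2)) hW.natFiltration P W U)
    {f : (Edge 3 L × Fin 2 × Fin 2 × Bool → ℝ) → ℝ} (hf : ContDiff ℝ 5 f) {ℓF : Edge 3 L → ℝ} (hℓF : ∀ e, 0 ≤ ℓF e) {MF : ℝ}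
    {g : (Edge 3 L × Fin 2 × Fin 2 × Bool → ℝ) → ℝ} (hg : ContDiff ℝ 5 g) {ℓG : Edge 3 L → ℝ} (hℓG : ∀ e, 0 ≤ ℓG e) {MG : ℝ}
    (Λf Λg : Finset (Edge 3 L)) (hΛf : ∀ e, e ∉ Λf → ℓF e = 0) (hΛg : ∀ e, e ∉ Λg → ℓG e = 0) (R : ℕ)
    (hsep : ∀ e' ∈ Λf, ∀ e ∈ Λg, R + 1 ≤ (Finset.univ.sup fun i : Fin 3 => ((e'.1 i - e.1 i).valMinAbs).natAbs)) :
    let coords : GaugeConfig 3 L (Matrix.specialUnitaryGroup (Fin 2) ℂ) → (Edge 3 L × Fin 2 × Fin 2 × Bool → ℝ) :=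
      fun V q => (fun z : ℂ => if q.2.2.2 then z.im else z.re)
        ((fundamentalRep (Fin 2) (V q.1) : Matrix (Fin 2) (Fin 2) ℂ) q.2.1 q.2.2.1)
    (∀ y, |f (coords y)| ≤ MF) → (∀ y, |g (coords y)| ≤ MG) →
    (∀ (e : Edge 3 L) (y y' : (GaugeConfig 3 L (Matrix.specialUnitaryGroup (Fin 2) ℂ))), (∀ f', f' ≠ e → y f' = y' f') →
      |f (coords y) - f (coords y')| ≤ ℓF e * frobNorm ((y e : Matrix (Fin 2) (Fin 2) ℂ) - (y' e : Matrix (Fin 2) (Fin 2) ℂ))) →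
    (∀ (e : Edge 3 L) (y y' : (GaugeConfig 3 L (Matrix.specialUnitaryGroup (Fin 2) ℂ))), (∀ f', f' ≠ e → y f' = y' f') →
      |g (coords y) - g (coords y')| ≤ ℓG e * frobNorm ((y e : Matrix (Fin 2) (Fin 2) ℂ) - (y' e : Matrix (Fin 2) (Fin 2) ℂ))) →
    |(∫ ω, f (coords (U t ω)) * g (coords (U t ω)) ∂P) - (∫ ω, f (coords (U t ω)) ∂P) * (∫ ω, g (coords (U t ω)) ∂P)| ≤
      8 * (∑ e : Edge 3 L, ℓF e) * (∑ e : Edge 3 L, ℓG e) * (1 + (((R : ℝ) + 1) * Real.log 108 / ((1300 + 4 * Real.sqrt 2) * |β'| + (1 - 12 * |β'|)))) * Real.exp (-((1 - 12 * |β'|) * (((R : ℝ) + 1) * Real.log 108 / ((1300 + 4 * Real.sqrt 2) * |β'| + (1 - 12 * |β'|))))) +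
      12 * Real.pi * ((3 * (((1300 + 4 * Real.sqrt 2) * |β'| + (1 - 12 * |β'|)) * (t : ℝ)) + 1) ^ 3 + 2) * Real.exp (-((1 - 12 * |β'|) * (t : ℝ))) *
        (((Λf ∪ Λg).card : ℝ) * Real.sqrt (∑ e : Edge 3 L, (MF * ℓG e + MG * ℓF e) ^ 2) +
          MG * (Λf.card : ℝ) * Real.sqrt (∑ e : Edge 3 L, ℓF e ^ 2) + MF * (Λg.card : ℝ) * Real.sqrt (∑ e : Edge 3 L, ℓG e ^ 2)) := by
  intro coords hMF hMG hLf hLg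
  classical
  haveI := secondCountableTopology_su2
  haveI := borelSpace_config L
  obtain ⟨κ, hκ, -, hreal⟩ := exists_transitionKernel L β'
  haveI := hκ
  have h := transition_covariance_abs_le_of_separated L β' hβ κ hreal hf hℓF hg hℓG Λf Λg hΛf hΛg R hsep t x₀ hMF hMG hLf hLg
  have hlaw : κ t x₀ = P.map (U t) := hreal t x₀ Ω P W hW U hU0 hU
  have hmU : Measurable (U t) := (hU.adapted t).mono (hW.natFiltration.le t) le_rfl
  have hco : Continuous coords := continuous_coords (L := L)
  have hFm : Measurable fun y : (GaugeConfig 3 L (Matrix.specialUnitaryGroup (Fin 2) ℂ)) => f (coords y) :=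
    (hf.continuous.comp hco).measurable
  have hGm : Measurable fun y : (GaugeConfig 3 L (Matrix.specialUnitaryGroup (Fin 2) ℂ)) => g (coords y) :=
    (hg.continuous.comp hco).measurable
  have hFGm : Measurable fun y : (GaugeConfig 3 L (Matrix.specialUnitaryGroup (Fin 2) ℂ)) => f (coords y) * g (coords y) :=
    hFm.mul hGm
  have e1 : ∫ y, f (coords y) * g (coords y) ∂(κ t x₀) = ∫ ω, f (coords (U t ω)) * g (coords (U t ω)) ∂P := by
    rw [hlaw, integral_map hmU.aemeasurable hFGm.aestronglyMeasurable]
  have e2 : ∫ y, f (coords y) ∂(κ t x₀) = ∫ ω, f (coords (U t ω)) ∂P := by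
    rw [hlaw, integral_map hmU.aemeasurable hFm.aestronglyMeasurable]
  have e3 : ∫ y, g (coords y) ∂(κ t x₀) = ∫ ω, g (coords (U t ω)) ∂P := by
    rw [hlaw, integral_map hmU.aemeasurable hGm.aestronglyMeasurable]
  rw [← e1, ← e2, ← e3]
  exact h

end Summit.QuantumFields.YangMills.Theorems.ColdStartUniversality.LiebRobinson
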